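import Mathlib
import Literature.NumberTheory.Automorphic.GaloisActionPlaces
import HarnessLib

/-!
# In a Galois CM field, if one prime above `p` is moved by complex conjugation then every prime above `p` is

Topic `Literature/NumberTheory/NumberFields`, namespace `Literature.NumberTheory.NumberFields`.  THEOREMS ONLY (no `def`, no
instance, no named fact), Mathlib + ★ `Automorphic/GaloisActionPlaces` (the action `σ • w` of a group of ring automorphisms on the
finite places `HeightOneSpectrum (𝓞 L)`, `instMulActionHeightOneSpectrum` — the currency of the letter C3
`RecordCurveCongruenceOnPoints`: «`(IsCMField.complexConj F) • w ≠ w`»).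

## Source (read at the page)

J. S. Milne, *The fundamental theorem of complex multiplication* (2007), §1: «the involution `ι_E` … `φ ∘ ι_E = ι ∘ φ` for every
`φ : E → ℂ`» — every automorphism of a CM field commutes with complex conjugation (tree ★
`Literature.NumberTheory.ComplexMultiplication.HalfTransfer.algEquiv_complexConj_comm`, re-proved here as a private helper to keep the
imports light); J. Neukirch, *Algebraic Number Theory* (1999), Ch. I (9.1)∕Ch. II §9: the Galois group of a Galois extension acts
TRANSITIVELY on the primes above a given prime (Mathlib `Ideal.exists_smul_eq_of_isGaloisGroup`).  The statement recorded — for `L/ℚ`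
Galois and CM, complex conjugation `c` commutes with `Gal(L/ℚ)`, so the set of primes `w` with `c • w ≠ w` is a union of
`Gal(L/ℚ)`-orbits, i.e. of fibres over `Spec ℤ` — is the standard consequence. [folklore]

## What is formalised (`L` a CM number field; `c = IsCMField.complexConj L : L ≃ₐ[L⁺] L`)

* `algEquiv_smul_complexConj_smul` — `σ • (c • w) = c • (σ • w)` on finite places, for every `σ : L ≃ₐ[ℚ] L` (no Galois hypothesis);
* `exists_algEquiv_smul_eq_of_under_eq` — `[IsGalois ℚ L]`: two finite places over the same prime of `ℤ` are `Gal(L/ℚ)`-conjugate;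
* **`complexConj_smul_ne_of_under_eq`** — `[IsGalois ℚ L]`: if `w, w′` lie over the same prime of `ℤ` and `c • w ≠ w`, then
  `c • w′ ≠ w′`; and the `=` companion `complexConj_smul_eq_of_under_eq`.
Cell `hodgecm-mathlib` FLOOR 0 P5a, plan (g5) row G12 (MOD-ROAD-P″ add2 §B1 (b): under the letter's `[IsGalois ℚ F]` every place of
`F⁺` above `p` splits in `F` as soon as the letter's `w` does — «no inert-banal places»); `--supports stmt-HodgeConjecture-24832`,
count-neutral.

## Mathlib / tree search

Mathlib: `IsCMField.complexConj`, `IsCMField.complexEmbedding_complexConj`, `NumberField.RingOfIntegers` `MulSemiringAction` ∕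
`SMulDistribClass` instances (`NumberField/Basic`), `IsGaloisGroup` instances for `𝓞` (`FieldTheory/Galois/IsGaloisGroup`),
`Ideal.exists_smul_eq_of_isGaloisGroup` (`RamificationInertia/Galois`), `Ideal.pointwise_smul_def`, `smul_left_cancel`.  Tree: ★
`GaloisActionPlaces` (`HeightOneSpectrum.smul_asIdeal`), ★ `HalfTransfer.algEquiv_complexConj_comm` (same statement, heavier imports),
`Summits/Ventures/HodgeRepro2/T5SplittingOrbitNumberField` (transitivity incantation).
-/

namespace Literature.NumberTheory.NumberFields

open NumberField IsDedekindDomain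
open scoped Pointwise

variable {L : Type*} [Field L] [NumberField L] [IsCMField L]

/-- Every `ℚ`-automorphism of a CM field commutes with complex conjugation (read through an embedding `ψ : L → ℂ`: both sides go
to `conj (ψ (σ x))`).  Private copy of ★ `HalfTransfer.algEquiv_complexConj_comm`. [cite: Milne2007FundamentalCM, §1] -/
private theorem algEquiv_complexConj_comm' (σ : L ≃ₐ[ℚ] L) (x : L) :
    σ (IsCMField.complexConj L x) = IsCMField.complexConj L (σ x) := by
  let ψ : L →+* ℂ := Classical.choice inferInstance
  apply ψ.injective
  have h1 := IsCMField.complexEmbedding_complexConj (K := L) (ψ.comp (σ : L →+* L)) x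
  have h2 := IsCMField.complexEmbedding_complexConj (K := L) ψ (σ x)
  rw [RingHom.comp_apply, RingHom.comp_apply] at h1
  change ψ (σ (IsCMField.complexConj L x)) = starRingEnd ℂ (ψ (σ x)) at h1
  rw [h1, h2]

/-- **`σ • (c • w) = c • (σ • w)`** on the finite places of a CM field, for every `σ ∈ Aut(L/ℚ)` and `c` complex conjugation: the
two pointwise images of the prime `𝔭_w` are the images under `σ ∘ c = c ∘ σ`. [cite: Milne2007FundamentalCM, §1] -/
theorem algEquiv_smul_complexConj_smul (σ : L ≃ₐ[ℚ] L) (w : HeightOneSpectrum (𝓞 L)) :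
    σ • (IsCMField.complexConj L • w) = IsCMField.complexConj L • (σ • w) := by
  apply HeightOneSpectrum.ext
  simp only [Literature.NumberTheory.Automorphic.HeightOneSpectrum.smul_asIdeal, Ideal.pointwise_smul_def, Ideal.map_map]
  congr 1
  refine RingHom.ext fun y => ?_
  apply RingOfIntegers.ext
  change σ (IsCMField.complexConj L (y : L)) = IsCMField.complexConj L (σ (y : L))
  exact algEquiv_complexConj_comm' σ y

omit [IsCMField L] in
/-- **Transitivity on the finite places**: in a Galois number field two finite places over the same prime of `ℤ` are conjugate under
`Gal(L/ℚ)` (Mathlib `Ideal.exists_smul_eq_of_isGaloisGroup`, transported to `HeightOneSpectrum`). [cite: NeukirchANT1999, Ch. I (9.1)] -/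
theorem exists_algEquiv_smul_eq_of_under_eq [IsGalois ℚ L] (w w' : HeightOneSpectrum (𝓞 L))
    (h : w'.asIdeal.under ℤ = w.asIdeal.under ℤ) : ∃ σ : L ≃ₐ[ℚ] L, σ • w = w' := by
  haveI : w.asIdeal.LiesOver (w.asIdeal.under ℤ) := ⟨rfl⟩
  haveI : w'.asIdeal.LiesOver (w.asIdeal.under ℤ) := ⟨h.symm⟩
  obtain ⟨σ, hσ⟩ := Ideal.exists_smul_eq_of_isGaloisGroup (w.asIdeal.under ℤ) w.asIdeal w'.asIdeal (L ≃ₐ[ℚ] L)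
  exact ⟨σ, HeightOneSpectrum.ext hσ⟩

/-- **In a Galois CM field, if one prime above `p` is moved by complex conjugation then so is every prime above `p`**: write
`w′ = σ • w` (transitivity); then `c • w′ = σ • (c • w) ≠ σ • w = w′` since `σ` commutes with `c` and acts injectively.  Under the
letter C3's `[IsGalois ℚ F]` this says: every place of `F⁺` above `p` splits in `F` as soon as the letter's `w` does.
[cite: Milne2007FundamentalCM, §1] [cite: NeukirchANT1999, Ch. I (9.1)] -/
theorem complexConj_smul_ne_of_under_eq [IsGalois ℚ L] (w w' : HeightOneSpectrum (𝓞 L))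
    (h : w'.asIdeal.under ℤ = w.asIdeal.under ℤ) (hw : IsCMField.complexConj L • w ≠ w) :
    IsCMField.complexConj L • w' ≠ w' := by
  obtain ⟨σ, rfl⟩ := exists_algEquiv_smul_eq_of_under_eq w w' h
  intro hc
  rw [← algEquiv_smul_complexConj_smul] at hc
  exact hw (smul_left_cancel σ hc)

/-- The complementary form: if one prime above `p` is FIXED by complex conjugation then every prime above `p` is.
[cite: Milne2007FundamentalCM, §1] [cite: NeukirchANT1999, Ch. I (9.1)] -/
theorem complexConj_smul_eq_of_under_eq [IsGalois ℚ L] (w w' : HeightOneSpectrum (𝓞 L))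
    (h : w'.asIdeal.under ℤ = w.asIdeal.under ℤ) (hw : IsCMField.complexConj L • w = w) :
    IsCMField.complexConj L • w' = w' := by
  by_contra hne
  exact complexConj_smul_ne_of_under_eq w' w h.symm hne hw

/-! ### ED. 2 — the same statements keyed by a rational prime `p ∈ 𝔭_w` (the letters' `((ℓ : ℕ) : 𝓞 F) ∈ w.asIdeal` currency)

A finite place `w` of `L` lies above the rational prime `p` iff `(p : 𝓞 L) ∈ 𝔭_w`; two such places have the same prime `(p)` of `ℤ`
below them ([NeukirchANT1999] Ch. I §8, «the prime ideals `𝔓` of `𝒪` lying over `p`, `𝔓 ∩ ℤ = pℤ`»), so ED. 1 applies to them. -/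

omit [NumberField L] [IsCMField L] in
/-- **Two finite places containing the same rational prime `p` lie over the same prime of `ℤ`**: both `𝔭_w ∩ ℤ` and `𝔭_{w′} ∩ ℤ`
are proper ideals containing the maximal ideal `pℤ`. [cite: NeukirchANT1999, Ch. I §8] -/
theorem under_int_eq_of_natCast_mem {p : ℕ} (hp : p.Prime) (w w' : HeightOneSpectrum (𝓞 L))
    (hw : (p : 𝓞 L) ∈ w.asIdeal) (hw' : (p : 𝓞 L) ∈ w'.asIdeal) : w'.asIdeal.under ℤ = w.asIdeal.under ℤ := by
  have hmax : (Ideal.span {(p : ℤ)}).IsMaximal :=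
    PrincipalIdealRing.isMaximal_of_irreducible (Nat.prime_iff_prime_int.mp hp).irreducible
  have key : ∀ v : HeightOneSpectrum (𝓞 L), (p : 𝓞 L) ∈ v.asIdeal → v.asIdeal.under ℤ = Ideal.span {(p : ℤ)} := by
    intro v hv
    refine (hmax.eq_of_le (Ideal.IsPrime.under ℤ v.asIdeal).ne_top ?_).symm
    rw [Ideal.span_singleton_le_iff_mem, Ideal.under_def, Ideal.mem_comap, map_natCast]
    exact hv
  rw [key w hw, key w' hw']

/-- **In a Galois CM field, if one prime containing `p` is moved by complex conjugation then so is every prime containing `p`**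
(ED. 1 `complexConj_smul_ne_of_under_eq` over `under_int_eq_of_natCast_mem`): under the letters' `[IsGalois ℚ F]`, every place of
`F⁺` above `p` splits in `F` as soon as the letters' split `w ∋ p` exists. [cite: Milne2007FundamentalCM, §1] [cite: NeukirchANT1999, Ch. I (9.1)] -/
theorem complexConj_smul_ne_of_natCast_mem [IsGalois ℚ L] {p : ℕ} (hp : p.Prime) (w w' : HeightOneSpectrum (𝓞 L))
    (hw : (p : 𝓞 L) ∈ w.asIdeal) (hw' : (p : 𝓞 L) ∈ w'.asIdeal) (hcw : IsCMField.complexConj L • w ≠ w) :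
    IsCMField.complexConj L • w' ≠ w' :=
  complexConj_smul_ne_of_under_eq w w' (under_int_eq_of_natCast_mem hp w w' hw hw') hcw

/-- The complementary form keyed by `p`: if one prime containing `p` is FIXED by complex conjugation then every prime containing `p`
is. [cite: Milne2007FundamentalCM, §1] [cite: NeukirchANT1999, Ch. I (9.1)] -/
theorem complexConj_smul_eq_of_natCast_mem [IsGalois ℚ L] {p : ℕ} (hp : p.Prime) (w w' : HeightOneSpectrum (𝓞 L))
    (hw : (p : 𝓞 L) ∈ w.asIdeal) (hw' : (p : 𝓞 L) ∈ w'.asIdeal) (hcw : IsCMField.complexConj L • w = w) :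
    IsCMField.complexConj L • w' = w' :=
  complexConj_smul_eq_of_under_eq w w' (under_int_eq_of_natCast_mem hp w w' hw hw') hcw

/-- **`c • w = w ↔ c • w′ = w′` for two primes containing the same rational prime** (`L/ℚ` Galois CM): being split over `L⁺` is a
property of the rational prime below. [cite: Milne2007FundamentalCM, §1] [cite: NeukirchANT1999, Ch. I (9.1)] -/
theorem complexConj_smul_eq_iff_of_natCast_mem [IsGalois ℚ L] {p : ℕ} (hp : p.Prime) (w w' : HeightOneSpectrum (𝓞 L))
    (hw : (p : 𝓞 L) ∈ w.asIdeal) (hw' : (p : 𝓞 L) ∈ w'.asIdeal) :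
    IsCMField.complexConj L • w = w ↔ IsCMField.complexConj L • w' = w' :=
  ⟨complexConj_smul_eq_of_natCast_mem hp w w' hw hw', complexConj_smul_eq_of_natCast_mem hp w' w hw' hw⟩

end Literature.NumberTheory.NumberFields
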